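import Summits.NavierStokesRegularity.NavierStokesRegularity.Theses.RellichScar
import Summits.NavierStokesRegularity.NavierStokesRegularity.Theorems.SymmetricScarExists.Negative.SpiralWorld
import Summits.NavierStokesRegularity.NavierStokesRegularity.Theorems.RellichScarSymmetricScarExistsOrbitScarRigidity
import Summits.NavierStokesRegularity.NavierStokesRegularity.Theorems.RellichScarSymmetricScarExistsDssNearOne
import Summits.NavierStokesRegularity.NavierStokesRegularity.Theorems.RellichScarSymmetricScarExistsFlatScrewSource
import Summits.NavierStokesRegularity.NavierStokesRegularity.Theorems.RellichScarSymmetricScarExistsRdssPineauVicolCorners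

/-!
# Crux `SymmetricScarExists` (stmt-NavierStokesRegularity-11718), line `rdss-screw-split`: three calibrations of the children

Helper file of the line lead (c3; `--supports stmt-NavierStokesRegularity-11718`; theorems only).  Three short
consequences of the landed pieces of the screw split `S ⇐ A ∧ B ∧ C` that the planners of the three children
should have as theorems rather than prose:

* `rdssScarSelection_witness_of_spiralScar` (child A): a singular apex profile whose SCAR is spiral with pitch
  `α` — the third one-parameter subgroup `λ ↦ R_{2α log λ} D_λ` of `ℝ₊ × SO(2)` that the crux's dichotomy omits
  (`Negative.SpiralScar`, Disproof §4) — witnesses A's first alternative with the screw `(2, 2α log 2)`.  So A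
  covers the omitted class at the level of scars (not only for a.e.-RSS profiles, `rdssScarSelection_witness_of_aeScrewInvariant`).
* `rdssApexFatal_rationalAngle_nearOne` (child C): a screw `(c, θ)` with RATIONAL angle `q θ = 2π m` has the
  untwisted power `(c, θ)^q = (c^q, 2π m) = D_{c^q}`; so the landed corner `dssApexFatal_nearOne` (Chae–Wolf
  2017 Thm 1.3) kills every a.e. `(c, θ)`-invariant singular apex profile with `c^q` below Chae–Wolf's
  threshold `c₁(C)` — a corner of C transverse to the slow/fast-spin cones of Pineau–Vicol.
* `no_slowFlatScrewSource_of_rdssScarRigidity` (what child B buys): granted B, NO sequence of singular apex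
  profiles (bounded `𝐈`, one constant `C > 0`) has its SCAR screw defect at a slow near-identity screw
  `(c, θ)` (`1 < c < c₁(C)`, `|θ| ≤ 2α₁(C) log c`) tending to zero — the robust Chae–Wolf statement in scar
  form (the strategist's P3), by `screwDefectLimit` + B + `rdssApexFatal_pineauVicol_slow`.  Unconditionally
  only the whole-profile `L³_loc` form holds (`Robust.rdss_robustSlowScrew`).

References: D. Chae, J. Wolf, arXiv:1610.09464, Thm 1.3 [ChaeWolf2017RemovingDSS]; B. Pineau, V. Vicol,
arXiv:2607.09619, Thm 1.7, Remark 1.5 [PineauVicol2026]; Z. Bradshaw, T.-P. Tsai, Comm. PDE 42 (2017), §1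
[BradshawTsai2017CPDE].
-/

noncomputable section

open MeasureTheory Set Function Filter Topology TopologicalSpace Metric
open scoped NNReal ENNReal

namespace Summit.NavierStokesRegularity.NavierStokesRegularity.Theorems.SymmetricScarExists.RdssSplit.Calibration

open Literature.Analysis.FluidPDE
open Summit.NavierStokesRegularity.NavierStokesRegularity.Theses.RellichScar
open Summit.NavierStokesRegularity.NavierStokesRegularity.Theorems.SymmetricScarExists.Negative
open Summit.NavierStokesRegularity.NavierStokesRegularity.Theorems.SymmetricScarExists.ScarWindow
open Summit.NavierStokesRegularity.NavierStokesRegularity.Theorems.SymmetricScarExists.RdssSplit.Orbit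
open Summit.NavierStokesRegularity.NavierStokesRegularity.Theorems.SymmetricScarExists.RdssSplit.FlatScrew
open Summit.NavierStokesRegularity.NavierStokesRegularity.Theorems.SymmetricScarExists.RdssSplit.PineauVicol

set_option linter.dupNamespace false

/-! ## §1 Child A covers spiral scars -/

/-- A spiral scar of pitch `α` is fixed by the screw `(2, 2α log 2)`. [cite: PineauVicol2026, Remark 1.5] -/
theorem screwFixedScar_of_spiralScar {α : ℝ} {u : ℝ → EuclideanSpace ℝ (Fin 3) → EuclideanSpace ℝ (Fin 3)}
    (h : SpiralScar α u) : ∃ c θ : ℝ, 1 < c ∧ SameScar (conjZ θ (nsRescale c u)) u :=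
  ⟨2, 2 * α * Real.log 2, one_lt_two, h 2 two_pos⟩

/-- **A singular apex profile with a SPIRAL scar witnesses child A** (`RdssScarSelection`): its scar is fixed by
the screw `(2, 2α log 2)`, so A's first alternative holds with the profile itself as witness (constant `C' = C`).
Thus A covers, at the level of scars, the one-parameter subgroup that the crux's dichotomy omits.
[cite: PineauVicol2026, Remark 1.5] -/
theorem rdssScarSelection_witness_of_spiralScar :
    ∀ (u : ℝ → EuclideanSpace ℝ (Fin 3) → EuclideanSpace ℝ (Fin 3)) (p : ℝ → EuclideanSpace ℝ (Fin 3) → ℝ) (G : ℝ → EuclideanSpace ℝ (Fin 3) → EuclideanSpace ℝ (Fin 3) →L[ℝ] EuclideanSpace ℝ (Fin 3)) (C α : ℝ), IsSuitableWeakSolutionOn (slab (EuclideanSpace ℝ (Fin 3)) (Iio 0) isOpen_Iio) 1 0 u p → HasWeakSpatialGradientOn (slab (EuclideanSpace ℝ (Fin 3)) (Iio 0) isOpen_Iio) u G → typeIBound (Iio (0 : ℝ) ×ˢ univ) u p G < ⊤ → HasTypeIDecay C u → IsBackwardSingularPoint u 0 → SpiralScar α u → ∃ (C' : ℝ) (u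 : ℝ → EuclideanSpace ℝ (Fin 3) → EuclideanSpace ℝ (Fin 3)) (p : ℝ → EuclideanSpace ℝ (Fin 3) → ℝ) (G : ℝ → EuclideanSpace ℝ (Fin 3) → EuclideanSpace ℝ (Fin 3) →L[ℝ] EuclideanSpace ℝ (Fin 3)), IsSuitableWeakSolutionOn (slab (EuclideanSpace ℝ (Fin 3)) (Iio 0) isOpen_Iio) 1 0 u p ∧ HasWeakSpatialGradientOn (slab (EuclideanSpace ℝ (Fin 3)) (Iio 0) isOpen_Iio) u G ∧ typeIBound (Iio (0 : ℝ) ×ˢ univ) u p G < ⊤ ∧ HasTypeIDecay C' u ∧ IsBackwardSingularPoint u 0 ∧ ((∃ c θ : ℝ, 1 < c ∧ ∀ K : Set (EuclideanSpace ℝ (Fin 3)), IsCompact K → (0 : EuclideanSpace ℝ (Fin 3)) ∉ K → Tendsto (fun δ : ℝ => eLpNorm (uncurry (fun t x => rotZ θ (nsRescale c u t (rotZ (-θ) x))) - uncurry u) ⊤ (volume.restrict (Ioo (-δ) 0 ×ˢ K))) (nhdsWithin 0 (Ioi 0)) (nhds 0)) ∨ (∀ θ : ℝ, ∀ K : Set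 (EuclideanSpace ℝ (Fin 3)), IsCompact K → (0 : EuclideanSpace ℝ (Fin 3)) ∉ K → Tendsto (fun δ : ℝ => eLpNorm (uncurry (fun t x => rotZ θ (u t (rotZ (-θ) x))) - uncurry u) ⊤ (volume.restrict (Ioo (-δ) 0 ×ˢ K))) (nhdsWithin 0 (Ioi 0)) (nhds 0))) := by
  intro u p G C α hsw hwg hI hdec hsing hspiral
  obtain ⟨c, θ, hc, hscar⟩ := screwFixedScar_of_spiralScar hspiral
  exact ⟨C, u, p, G, hsw, hwg, hI, hdec, hsing, Or.inl ⟨c, θ, hc, hscar⟩⟩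

/-! ## §2 Child C at rational angles: the untwisted power -/

/-- `R_{2π m} = 1` for every integer `m`. [folklore] -/
theorem rotZ_two_pi_mul_int (m : ℤ) (x : EuclideanSpace ℝ (Fin 3)) : rotZ (2 * Real.pi * m) x = x := by
  have hc : Real.cos (2 * Real.pi * m) = 1 := by
    rw [mul_comm]; exact Real.cos_int_mul_two_pi m
  have hs : Real.sin (2 * Real.pi * m) = 0 := by
    have h := Real.sin_int_mul_pi (2 * m)
    push_cast at h
    rw [show (2 : ℝ) * Real.pi * m = 2 * (m : ℝ) * Real.pi by ring]
    exact h
  ext i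
  fin_cases i <;> simp [hc, hs]

/-- Rotation-conjugation by a full turn is the identity: `conjZ (2π m) w = w`. [folklore] -/
theorem conjZ_two_pi_mul_int (m : ℤ) (w : ℝ → EuclideanSpace ℝ (Fin 3) → EuclideanSpace ℝ (Fin 3)) :
    conjZ (2 * Real.pi * m) w = w := by
  funext t x
  have hneg : -(2 * Real.pi * (m : ℝ)) = 2 * Real.pi * ((-m : ℤ) : ℝ) := by push_cast; ring
  simp only [conjZ]
  rw [hneg, rotZ_two_pi_mul_int, rotZ_two_pi_mul_int]

/-- **A.e. screw invariance iterates**: if `R_θ D_c u = u` a.e. on the slab (`0 < c`), then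
`R_{nθ} D_{cⁿ} u = u` a.e. on the slab for every `n`. [folklore] -/
theorem ae_screw_pow {u : ℝ → EuclideanSpace ℝ (Fin 3) → EuclideanSpace ℝ (Fin 3)} {c θ : ℝ} (hc : 0 < c)
    (h : uncurry (conjZ θ (nsRescale c u)) =ᵐ[volume.restrict (Iio (0 : ℝ) ×ˢ (univ : Set (EuclideanSpace ℝ (Fin 3))))] uncurry u) :
    ∀ n : ℕ, uncurry (conjZ ((n : ℝ) * θ) (nsRescale (c ^ n) u))
      =ᵐ[volume.restrict (Iio (0 : ℝ) ×ˢ (univ : Set (EuclideanSpace ℝ (Fin 3))))] uncurry u := by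
  intro n
  induction n with
  | zero =>
    simp only [Nat.cast_zero, zero_mul, pow_zero, nsRescale_one, conjZ_zero]
    exact EventuallyEq.rfl
  | succ n ih =>
    have e : conjZ (((n + 1 : ℕ) : ℝ) * θ) (nsRescale (c ^ (n + 1)) u) =
        conjZ θ (nsRescale c (conjZ ((n : ℝ) * θ) (nsRescale (c ^ n) u))) := by
      rw [screw_screw, pow_succ']
      congr 1
      push_cast
      ring
    rw [e]
    exact (conjZ_ae_eq_slab θ (nsRescale_ae_eq_slab hc ih)).trans h

/-- **No a.e. `(c, θ)`-invariant singular apex profile with rational angle and small untwisted power** (child C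
at rational angles; registered auxiliary stub `rdssApexFatal_rationalAngle_nearOne`).  For every `C > 0`, with
Chae–Wolf's threshold `c₁ = c₁(C) > 1` of `dssApexFatal_nearOne`: if `q θ = 2π m` (`q ≥ 1`) and
`c^q < c₁`, then no suitable weak solution on the slab with a weak gradient, `𝐈 < ∞` and the apex bound of
constant `C`, singular at the origin, is a.e. `(c, θ)`-screw-invariant — because it would be a.e.
`c^q`-discretely self-similar. [cite: ChaeWolf2017RemovingDSS, Theorem 1.3 (arXiv:1610.09464 p. 3)] -/
theorem rdssApexFatal_rationalAngle_nearOne :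
    ∀ C : ℝ, 0 < C → ∃ c₁ : ℝ, 1 < c₁ ∧ ∀ (c θ : ℝ) (q : ℕ) (m : ℤ), 0 < q → (q : ℝ) * θ = 2 * Real.pi * m → 1 < c → c ^ q < c₁ → ∀ (u : ℝ → EuclideanSpace ℝ (Fin 3) → EuclideanSpace ℝ (Fin 3)) (p : ℝ → EuclideanSpace ℝ (Fin 3) → ℝ) (G : ℝ → EuclideanSpace ℝ (Fin 3) → EuclideanSpace ℝ (Fin 3) →L[ℝ] EuclideanSpace ℝ (Fin 3)), IsSuitableWeakSolutionOn (slab (EuclideanSpace ℝ (Fin 3)) (Iio 0) isOpen_Iio) 1 0 u p → HasWeakSpatialGradientOn (slab (EuclideanSpace ℝ (Fin 3)) (Iio 0) isOpen_Iio) u G → typeIBound (Iio (0 : ℝ) ×ˢ univ) u p G < ⊤ → HasTypeIDecay C u → IsBackwardSingularPoint u 0 → uncurry (fun t x => rotZ θ (nsRescale c u t (rotZ (-θ) x))) =ᵐ[volume.restrict (Iio (0 : ℝ) ×ˢ univ)] uncurry u → False := by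
  intro C hC
  obtain ⟨c₁, hc₁, H⟩ := dssApexFatal_nearOne C hC
  refine ⟨c₁, hc₁, fun c θ q m hq hqθ hc hcq u p G hsw hwg hI hdec hsing hrdss => ?_⟩
  have hc0 : 0 < c := one_pos.trans hc
  -- the `q`-th power of the screw is the untwisted dilation by `c^q`
  have hpow := ae_screw_pow hc0 hrdss q
  rw [hqθ, conjZ_two_pi_mul_int] at hpow
  have h1 : 1 < c ^ q := one_lt_pow₀ hc (Nat.pos_iff_ne_zero.1 hq)
  exact H (c ^ q) h1 hcq u p G hsw hwg hI hdec hsing hpow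

/-! ## §3 What child B buys: the robust slow-screw exclusion in scar form -/

/-- **Granted child B, no scar-flat slow-screw sequences** (the robust Chae–Wolf statement in SCAR form; registered
auxiliary stub `no_slowFlatScrewSource_of_rdssScarRigidity`).  Assume `RdssScarRigidity` (B).  For every
`C > 0`, with Pineau–Vicol's `α₁(C) > 0`, `c₁(C) > 1` (`rdssApexFatal_pineauVicol_slow`): for `1 < c < c₁` and
`|θ| ≤ 2α₁ log c` there is NO sequence of suitable weak solutions on the slab (weak gradients, `𝐈 ≤ I < ∞`, the
apex bound of constant `C`, singular origins) whose scar screw defect at `(c, θ)` tends to zero (eventually along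
the sequence, essentially near the final slice, on every compact `K ∌ 0`).  Proof: compactness
(`stub_slabLimit`) and the screw defect limit (`screwDefectLimit`) give a singular apex limit whose scar is fixed
by `(c, θ)`; B makes it a.e. screw-invariant; the slow corner excludes it.
[cite: PineauVicol2026, Theorem 1.7 (i) (arXiv:2607.09619 p. 7); AlbrittonBarker2019, Lemma 2.2 and Prop. 2.3] -/
theorem no_slowFlatScrewSource_of_rdssScarRigidity :
    (∀ (u : ℝ → EuclideanSpace ℝ (Fin 3) → EuclideanSpace ℝ (Fin 3)) (p : ℝ → EuclideanSpace ℝ (Fin 3) → ℝ) (G : ℝ → EuclideanSpace ℝ (Fin 3) → EuclideanSpace ℝ (Fin 3) →L[ℝ] EuclideanSpace ℝ (Fin 3)) (C c θ : ℝ), IsSuitableWeakSolutionOn (slab (EuclideanSpace ℝ (Fin 3)) (Iio 0) isOpen_Iio) 1 0 u p → HasWeakSpatialGradientOn (slab (EuclideanSpace ℝ (Fin 3)) (Iio 0) isOpen_Iio) u G → typeIBound (Iio (0 : ℝ) ×ˢ univ) u p G < ⊤ → HasTypeIDecay C u → IsBackwardSingularPoint u 0 → 1 < c → (∀ K : Set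 (EuclideanSpace ℝ (Fin 3)), IsCompact K → (0 : EuclideanSpace ℝ (Fin 3)) ∉ K → Tendsto (fun δ : ℝ => eLpNorm (uncurry (fun t x => rotZ θ (nsRescale c u t (rotZ (-θ) x))) - uncurry u) ⊤ (volume.restrict (Ioo (-δ) 0 ×ˢ K))) (nhdsWithin 0 (Ioi 0)) (nhds 0)) → uncurry (fun t x => rotZ θ (nsRescale c u t (rotZ (-θ) x))) =ᵐ[volume.restrict (Iio (0 : ℝ) ×ˢ univ)] uncurry u) → ∀ C : ℝ, 0 < C → ∃ α₁ c₁ : ℝ, 0 < α₁ ∧ 1 < c₁ ∧ ∀ (c θ : ℝ), 1 < c → c < c₁ → |θ| ≤ 2 * α₁ * Real.log c → ∀ (I : ENNReal) (v : ℕ → ℝ → EuclideanSpace ℝ (Fin 3) → EuclideanSpace ℝ (Fin 3)) (q : ℕ → ℝ → EuclideanSpace ℝ (Fin 3) → ℝ) (H : ℕ → ℝ → EuclideanSpace ℝ (Fin 3) → EuclideanSpace ℝ (Fin 3) →L[ℝ] EuclideanSpace ℝ (Fin 3)), I < ⊤ → (∀ k : ℕ, IsSuitableWeakSolutionOn (slab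 (EuclideanSpace ℝ (Fin 3)) (Iio 0) isOpen_Iio) 1 0 (v k) (q k) ∧ HasWeakSpatialGradientOn (slab (EuclideanSpace ℝ (Fin 3)) (Iio 0) isOpen_Iio) (v k) (H k) ∧ typeIBound (Iio (0 : ℝ) ×ˢ univ) (v k) (q k) (H k) ≤ I ∧ HasTypeIDecay C (v k) ∧ IsBackwardSingularPoint (v k) 0) → (∀ K : Set (EuclideanSpace ℝ (Fin 3)), IsCompact K → (0 : EuclideanSpace ℝ (Fin 3)) ∉ K → ∀ ε : ℝ, 0 < ε → ∀ᶠ k in atTop, ∀ᶠ δ in nhdsWithin (0 : ℝ) (Ioi 0), eLpNorm (uncurry (fun t x => rotZ θ (nsRescale c (v k) t (rotZ (-θ) x))) - uncurry (v k)) ⊤ (volume.restrict (Ioo (-δ) 0 ×ˢ K)) ≤ ENNReal.ofReal ε) → False := by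
  intro hB C hC
  obtain ⟨α₁, c₁, hα₁, hc₁, Hcorner⟩ := rdssApexFatal_pineauVicol_slow C hC
  refine ⟨α₁, c₁, hα₁, hc₁, fun c θ hc hcc hθ I v q H hI hfam hflat => ?_⟩
  have hc0 : 0 < c := one_pos.trans hc
  -- compactness: a singular apex limit along a subsequence
  obtain ⟨u, p, G, φ, hφ, hsu, hwg, hIu, hdu, hsing, hconv⟩ := stub_slabLimit C I v q H hC.le hI hfam
  have hw : ∀ j : ℕ, IsSuitableWeakSolutionOn (slab (EuclideanSpace ℝ (Fin 3)) (Iio (0 : ℝ)) isOpen_Iio) 1 0 (v (φ j)) (q (φ j)) ∧ HasWeakSpatialGradientOn (slab (EuclideanSpace ℝ (Fin 3)) (Iio (0 : ℝ)) isOpen_Iio) (v (φ j)) (H (φ j)) ∧ typeIBound (Iio (0 : ℝ) ×ˢ univ) (v (φ j)) (q (φ j)) (H (φ j)) < ⊤ ∧ HasTypeIDecay C (v (φ j)) :=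
    fun j => ⟨(hfam (φ j)).1, (hfam (φ j)).2.1, lt_of_le_of_lt (hfam (φ j)).2.2.1 hI, (hfam (φ j)).2.2.2.1⟩
  -- the scar of the limit is fixed by the screw
  have hS : SameScar (conjZ θ (nsRescale c u)) u :=
    screwDefectLimit C (fun j => v (φ j)) (fun j => q (φ j)) (fun j => H (φ j)) u p G hC hw hsu hwg hIu hdu
      hconv hc0 θ fun K hK h0 ε hε => hφ.tendsto_atTop.eventually (hflat K hK h0 ε hε)
  -- child B: the limit is a.e. screw-invariant; the slow corner excludes it
  exact Hcorner c θ hc hcc hθ u p G hsu hwg hIu hdu hsing (hB u p G C c θ hsu hwg hIu hdu hsing hc hS)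

end Summit.NavierStokesRegularity.NavierStokesRegularity.Theorems.SymmetricScarExists.RdssSplit.Calibration

end
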